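import Summits.QuantumFields.BalabanUV.Beta.ChartConjugation
import Literature.MathematicalPhysics.QuantumFieldTheory.Balaban1983to89.Beta.BalabanStepJetsSucc

/-!
# `BalabanUV.Beta.ChartConjugationRelative` — the chart-conjugation defect identity over a RELATIVE inverse
# (`E∘A = A = A∘E`, `A∘𝕄∘E = E = E∘𝕄∘A`): kernel-level twin of an2's matrix certificate `jet₂_defect_relative`
# (β sub-cell, row BETA-an2, gen 12; item (iii′) of NOTE X-an2-41 §4 — the RELATIVE form of an5's `ChartConjugation` §2)

HONEST FRAMING (cell contract, verbatim): «discharging `BetaPertH` makes Bałaban's UV stability UNCONDITIONAL — a real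
constructive-QFT result; it is NOT the continuum limit and NOT the Clay problem.»  THIS MODULE is elementary analysis on matrix-fibred
lattice kernels (absolutely convergent compositions and traces): it formalises NO statement printed in Bałaban's papers, cites none as a
hypothesis, mints no `Prop` fact (one `def … : Prop` PREDICATE — the four relative rules, a class like `TameKernelCalculus.Spr`, asserted nowhere),
instantiates NO binder of the wall and DISCHARGES NOTHING of it.  NOT summit progress; NOT continuum; NOT Clay.

ABSOLUTE RULE (cell, verbatim): «No internally-minted statement may enter as a cited fact. Every hypothesis is either
kernel-proved in this package or a verbatim quotation of a PUBLISHED theorem with page reference. The manuscript(s) under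
audit are NOT citable for their own disputed steps — they are the thing under adjudication; programme-internal
(2001/route/tribunal) claims are never citable.»  Every theorem below is kernel-proved from explicit, abstract hypotheses.

WHY (X-an2-41 §1–§2).  an5's `ChartConjugation.hess_conj_invariant` (the assembled one-loop Hessian form is blind to the
chart-conjugation contacts) asks for a TWO-SIDED inverse `A∘𝕄 = idK = 𝕄∘A`.  The wall's family is axially DRESSED; by
`AxialDressingRootedHessian.TbalOf_dressAt` its one-step kernels are `hessKer G_j (vertexOfK G_j …) W` with `G_j = Π·KInvStep_j·Πᵀ`
the CO-DRESSED resolvent, which is only a RELATIVE inverse of the gauge-invariant undressed bordered Hessian: for the coordinate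
projector `E` onto the gauge-fixed subspace, `E∘G = G = G∘E`, `G∘𝕄∘E = E = E∘𝕄∘G` — and `G∘𝕄 ≠ idK`.  This file re-proves an5's §2
from exactly these four rules (`RelInv A 𝕄 E`) plus `E∘X = X∘E` for the contact generators (bond-diagonal re-chartings commute with
the coordinate projector); with `E := idK` every statement specialises to an5's (`RelInv.of_two_sided`).

CONTENT.  §1 `RelInv A 𝕄 E` (the four rules, a `Prop`-valued predicate — HYPOTHESES), `RelInv.of_two_sided`; the SANDWICHED rules
`rule_right_rel : (A∘X)∘(𝕄∘A) = A∘X`, `rule_left_rel : (A∘𝕄)∘(X∘A) = X∘A`, `trace_KHY_rel : tr(A∘(𝕄∘Y)) = tr(E∘Y)`,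
`trace_KYH_rel : tr(A∘(Y∘𝕄)) = tr(E∘Y)` (`X`, `Y` localised, commuting with `E`).  §2 `sandwich_rel`, `bubble_conjV_left_rel`,
`bubble_conjV_right_rel`, `tadpole_conjW₁_rel`, `tadpole_conjW₂_rel`, **`conj_defect_rel`**, **`hess_conj_invariant_rel`** — the
statements of an5's `sandwich` / `bubble_conjV_*` / `tadpole_conjW₁/₂` / `conj_defect` / `hess_conj_invariant` VERBATIM, with
`(hAM, hMA)` replaced by `(hE : Spr E) (hR : RelInv A 𝕄 E)` and the commutations `E∘X = X∘E`, `E∘X′ = X′∘E`, `E∘X₂ = X₂∘E`.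

RELATION TO THE TREE (no duplication): the contacts `conjV`/`conjW₁`/`conjW₂`/`conjW`, their `Loc`-closure, `tadpole_comm_pair`
and every analytic brick (`TameKernelCalculus`) are an5's, USED BY NAME; only the seven inverse-dependent lemmas are re-proved.
The finite-dimensional shadow is an2's `AssembledJetChartCovarianceRelative` (p197692), not imported.
-/

open Finset
open scoped BigOperators
open Literature.MathematicalPhysics.QuantumFieldTheory.Balaban1983to89
open Literature.MathematicalPhysics.QuantumFieldTheory.Balaban1983to89.Beta
open ExpKernelCalculus (MKer Decays BiLoc comp tr bubble tadpole)
open HessKerSchurResolvent (idK comp_idK_left comp_idK_right)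
open Summit.QuantumFields.BalabanUV.Beta.TameKernelCalculus
open Summit.QuantumFields.BalabanUV.Beta.ChartConjugation

namespace Summit.QuantumFields.BalabanUV.Beta.ChartConjugationRelative

noncomputable section

variable {D : ℕ} {F : Type*} [Fintype F]

/-! ## §1 The relative-inverse hypotheses and the sandwiched rules -/

/-- **THE FOUR RELATIVE RULES** (a PREDICATE on three kernels — HYPOTHESES, asserted nowhere): `E∘A = A`, `A∘E = A` (the resolvent
lives on the range of `E`), `(A∘𝕄)∘E = E`, `(E∘𝕄)∘A = E` (it inverts `𝕄` ON that range).  For `E = idK`: a two-sided inverse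
(`RelInv.of_two_sided`). -/
def RelInv (A M E : MKer D F) : Prop :=
  comp E A = A ∧ comp A E = A ∧ comp (comp A M) E = E ∧ comp (comp E M) A = E

/-- Rule `E∘A = A`. -/
theorem RelInv.EA {A M E : MKer D F} (h : RelInv A M E) : comp E A = A := h.1

/-- Rule `A∘E = A`. -/
theorem RelInv.AE {A M E : MKer D F} (h : RelInv A M E) : comp A E = A := h.2.1

/-- Rule `(A∘𝕄)∘E = E`. -/
theorem RelInv.AME {A M E : MKer D F} (h : RelInv A M E) : comp (comp A M) E = E := h.2.2.1

/-- Rule `(E∘𝕄)∘A = E`. -/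
theorem RelInv.EMA {A M E : MKer D F} (h : RelInv A M E) : comp (comp E M) A = E := h.2.2.2

/-- A two-sided inverse is a relative inverse with `E = idK`. -/
theorem RelInv.of_two_sided [DecidableEq F] {A M : MKer D F} (hAM : comp A M = idK) (hMA : comp M A = idK) :
    RelInv A M (idK : MKer D F) :=
  ⟨comp_idK_left A, comp_idK_right A, by rw [hAM, comp_idK_left], by rw [comp_idK_left, hMA]⟩

section Rules

variable {A M E : MKer D F}

/-- Spread ∘ spread is spread (`BalabanStepJetsSucc.decays_comp` at the common rate, halved). -/
theorem spr_comp {P Q : MKer D F} (hP : Spr P) (hQ : Spr Q) : Spr (comp P Q) := by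
  obtain ⟨CP, δ₁, hδ₁, hP⟩ := hP
  obtain ⟨CQ, δ₂, hδ₂, hQ⟩ := hQ
  have hP' := decays_of_le hP (min_le_left δ₁ δ₂)
  have hQ' := decays_of_le hQ (min_le_right δ₁ δ₂)
  have hδ : 0 < min δ₁ δ₂ := lt_min hδ₁ hδ₂
  exact ⟨_, min δ₁ δ₂ / 2, by linarith,
    BalabanStepJetsSucc.decays_comp hP' hQ' (show 0 ≤ min δ₁ δ₂ / 2 by linarith) (show min δ₁ δ₂ / 2 < min δ₁ δ₂ by linarith)⟩

/-- `A∘X = (A∘X)∘E` for `X` commuting with `E` (from `A∘E = A`). -/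
theorem comp_eq_comp_comp_E (hA : Spr A) (hE : Spr E) (hR : RelInv A M E) {X : MKer D F} (hX : Loc X)
    (hEX : comp E X = comp X E) : comp A X = comp (comp A X) E :=
  calc comp A X = comp (comp A E) X := by rw [hR.AE]
    _ = comp A (comp E X) := (comp_assoc_tame hA.tame hE.tame hX.tame).symm
    _ = comp A (comp X E) := by rw [hEX]
    _ = comp (comp A X) E := comp_assoc_tame hA.tame hX.tame hE.tame

/-- `X∘A = E∘(X∘A)` for `X` commuting with `E` (from `E∘A = A`). -/
theorem comp_eq_E_comp_comp (hA : Spr A) (hE : Spr E) (hR : RelInv A M E) {X : MKer D F} (hX : Loc X)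
    (hEX : comp E X = comp X E) : comp X A = comp E (comp X A) :=
  calc comp X A = comp X (comp E A) := by rw [hR.EA]
    _ = comp (comp X E) A := comp_assoc_tame hX.tame hE.tame hA.tame
    _ = comp (comp E X) A := by rw [hEX]
    _ = comp E (comp X A) := (comp_assoc_tame hE.tame hX.tame hA.tame).symm

/-- **SANDWICHED RIGHT RULE** `(A∘X)∘(𝕄∘A) = A∘X` (the letters' `K·X·H·K = K·X`). -/
theorem rule_right_rel (hA : Spr A) (hM : Spr M) (hE : Spr E) (hR : RelInv A M E) {X : MKer D F} (hX : Loc X)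
    (hEX : comp E X = comp X E) : comp (comp A X) (comp M A) = comp A X := by
  have hAX : Loc (comp A X) := hA.comp_loc hX
  have hMA : Tame (comp M A) := (spr_comp hM hA).tame
  have h := comp_eq_comp_comp_E hA hE hR hX hEX
  calc comp (comp A X) (comp M A) = comp (comp (comp A X) E) (comp M A) := by rw [← h]
    _ = comp (comp A X) (comp E (comp M A)) := (comp_assoc_tame hAX.tame hE.tame hMA).symm
    _ = comp (comp A X) (comp (comp E M) A) := by rw [comp_assoc_tame hE.tame hM.tame hA.tame]
    _ = comp (comp A X) E := by rw [hR.EMA]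
    _ = comp A X := h.symm

/-- **SANDWICHED LEFT RULE** `(A∘𝕄)∘(X∘A) = X∘A` (the letters' `K·H·X·K = X·K`). -/
theorem rule_left_rel (hA : Spr A) (hM : Spr M) (hE : Spr E) (hR : RelInv A M E) {X : MKer D F} (hX : Loc X)
    (hEX : comp E X = comp X E) : comp (comp A M) (comp X A) = comp X A := by
  have hXA : Loc (comp X A) := hX.comp_spr hA
  have hAM : Tame (comp A M) := (spr_comp hA hM).tame
  have h := comp_eq_E_comp_comp hA hE hR hX hEX
  calc comp (comp A M) (comp X A) = comp (comp A M) (comp E (comp X A)) := by rw [← h]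
    _ = comp (comp (comp A M) E) (comp X A) := comp_assoc_tame hAM hE.tame hXA.tame
    _ = comp E (comp X A) := by rw [hR.AME]
    _ = comp X A := h.symm

/-- **TRACE RULE** `tr(A∘(𝕄∘Y)) = tr(E∘Y)` for localised `Y` commuting with `E` (the letters' `trace_KHY`). -/
theorem trace_KHY_rel (hA : Spr A) (hM : Spr M) (hE : Spr E) (hR : RelInv A M E) {Y : MKer D F} (hY : Loc Y)
    (hEY : comp E Y = comp Y E) : tr (comp A (comp M Y)) = tr (comp E Y) := by
  have hAM : Tame (comp A M) := (spr_comp hA hM).tame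
  have hYAM : Loc (comp Y (comp A M)) := hY.comp_spr (spr_comp hA hM)
  have h2 : comp Y (comp A M) = comp E (comp Y (comp A M)) :=
    calc comp Y (comp A M) = comp Y (comp (comp E A) M) := by rw [hR.EA]
      _ = comp Y (comp E (comp A M)) := by rw [← comp_assoc_tame hE.tame hA.tame hM.tame]
      _ = comp (comp Y E) (comp A M) := comp_assoc_tame hY.tame hE.tame hAM
      _ = comp (comp E Y) (comp A M) := by rw [hEY]
      _ = comp E (comp Y (comp A M)) := (comp_assoc_tame hE.tame hY.tame hAM).symm
  calc tr (comp A (comp M Y)) = tr (comp (comp A M) Y) := by rw [comp_assoc_tame hA.tame hM.tame hY.tame]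
    _ = tr (comp Y (comp A M)) := (tr_comp_comm_loc hY hAM).symm
    _ = tr (comp E (comp Y (comp A M))) := by rw [← h2]
    _ = tr (comp (comp Y (comp A M)) E) := (tr_comp_comm_loc hYAM hE.tame).symm
    _ = tr (comp Y (comp (comp A M) E)) := by rw [← comp_assoc_tame hY.tame hAM hE.tame]
    _ = tr (comp Y E) := by rw [hR.AME]
    _ = tr (comp E Y) := by rw [hEY]

/-- **TRACE RULE** `tr(A∘(Y∘𝕄)) = tr(E∘Y)` for localised `Y` commuting with `E` (the letters' `trace_KYH`). -/
theorem trace_KYH_rel (hA : Spr A) (hM : Spr M) (hE : Spr E) (hR : RelInv A M E) {Y : MKer D F} (hY : Loc Y)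
    (hEY : comp E Y = comp Y E) : tr (comp A (comp Y M)) = tr (comp E Y) := by
  have hMA : Tame (comp M A) := (spr_comp hM hA).tame
  have hYM : Loc (comp Y M) := hY.comp_spr hM
  have hYMA : Loc (comp Y (comp M A)) := hY.comp_spr (spr_comp hM hA)
  have h2 : comp Y (comp M A) = comp (comp Y (comp M A)) E :=
    calc comp Y (comp M A) = comp Y (comp M (comp A E)) := by rw [hR.AE]
      _ = comp Y (comp (comp M A) E) := by rw [comp_assoc_tame hM.tame hA.tame hE.tame]
      _ = comp (comp Y (comp M A)) E := comp_assoc_tame hY.tame hMA hE.tame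
  calc tr (comp A (comp Y M)) = tr (comp (comp Y M) A) := (tr_comp_comm_loc hYM hA.tame).symm
    _ = tr (comp Y (comp M A)) := by rw [← comp_assoc_tame hY.tame hM.tame hA.tame]
    _ = tr (comp (comp Y (comp M A)) E) := by rw [← h2]
    _ = tr (comp E (comp Y (comp M A))) := tr_comp_comm_loc hYMA hE.tame
    _ = tr (comp (comp E Y) (comp M A)) := by rw [comp_assoc_tame hE.tame hY.tame hMA]
    _ = tr (comp (comp Y E) (comp M A)) := by rw [hEY]
    _ = tr (comp Y (comp E (comp M A))) := by rw [← comp_assoc_tame hY.tame hE.tame hMA]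
    _ = tr (comp Y (comp (comp E M) A)) := by rw [comp_assoc_tame hE.tame hM.tame hA.tame]
    _ = tr (comp Y E) := by rw [hR.EMA]
    _ = tr (comp E Y) := by rw [hEY]

end Rules

/-! ## §2 The defect identity and the invariance of the assembled one-loop Hessian form, relative version -/

section Defect

variable {A M E : MKer D F}

/-- `E` commutes with a composition of two kernels commuting with `E`. -/
theorem comm_comp (hE : Spr E) {X Y : MKer D F} (hX : Loc X) (hY : Loc Y) (hEX : comp E X = comp X E)
    (hEY : comp E Y = comp Y E) : comp E (comp X Y) = comp (comp X Y) E :=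
  calc comp E (comp X Y) = comp (comp E X) Y := comp_assoc_tame hE.tame hX.tame hY.tame
    _ = comp (comp X E) Y := by rw [hEX]
    _ = comp X (comp E Y) := (comp_assoc_tame hX.tame hE.tame hY.tame).symm
    _ = comp X (comp Y E) := by rw [hEY]
    _ = comp (comp X Y) E := comp_assoc_tame hX.tame hY.tame hE.tame

/-- THE SANDWICH IDENTITY, relative form: `(A ∘ conjV 𝕄 X) ∘ (A ∘ Z) = X ∘ (A∘Z) − (A∘X) ∘ Z` (uses the two sandwiched rules;
`Z` arbitrary localised). -/
theorem sandwich_rel (hA : Spr A) (hM : Spr M) (hE : Spr E) (hR : RelInv A M E) {X Z : MKer D F} (hX : Loc X) (hZ : Loc Z)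
    (hEX : comp E X = comp X E) :
    comp (comp A (conjV M X)) (comp A Z) = comp X (comp A Z) - comp (comp A X) Z := by
  have hAM : Tame (comp A M) := (spr_comp hA hM).tame
  have hMA : Tame (comp M A) := (spr_comp hM hA).tame
  have hMX : Loc (comp M X) := hM.comp_loc hX
  have hXM : Loc (comp X M) := hX.comp_spr hM
  have hAZ : Loc (comp A Z) := hA.comp_loc hZ
  have hAX : Loc (comp A X) := hA.comp_loc hX
  have hXA : Loc (comp X A) := hX.comp_spr hA
  have t1 : comp (comp A (comp M X)) (comp A Z) = comp X (comp A Z) :=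
    calc comp (comp A (comp M X)) (comp A Z) = comp (comp (comp A M) X) (comp A Z) := by
          rw [comp_assoc_tame hA.tame hM.tame hX.tame]
      _ = comp (comp A M) (comp X (comp A Z)) := (comp_assoc_tame hAM hX.tame hAZ.tame).symm
      _ = comp (comp A M) (comp (comp X A) Z) := by rw [comp_assoc_tame hX.tame hA.tame hZ.tame]
      _ = comp (comp (comp A M) (comp X A)) Z := comp_assoc_tame hAM hXA.tame hZ.tame
      _ = comp (comp X A) Z := by rw [rule_left_rel hA hM hE hR hX hEX]
      _ = comp X (comp A Z) := (comp_assoc_tame hX.tame hA.tame hZ.tame).symm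
  have t2 : comp (comp A (comp X M)) (comp A Z) = comp (comp A X) Z :=
    calc comp (comp A (comp X M)) (comp A Z) = comp (comp (comp A X) M) (comp A Z) := by
          rw [comp_assoc_tame hA.tame hX.tame hM.tame]
      _ = comp (comp A X) (comp M (comp A Z)) := (comp_assoc_tame hAX.tame hM.tame hAZ.tame).symm
      _ = comp (comp A X) (comp (comp M A) Z) := by rw [comp_assoc_tame hM.tame hA.tame hZ.tame]
      _ = comp (comp (comp A X) (comp M A)) Z := comp_assoc_tame hAX.tame hMA hZ.tame
      _ = comp (comp A X) Z := by rw [rule_right_rel hA hM hE hR hX hEX]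
  unfold conjV
  rw [comp_sub_right_tame hA.tame hMX.tame hXM.tame,
    comp_sub_left_tame (hA.comp_loc hMX).tame (hA.comp_loc hXM).tame hAZ.tame, t1, t2]

/-- Bubble with a first-slot contact (relative): `bubble A (conjV 𝕄 X) Z = tr(X∘(A∘Z)) − tr((A∘X)∘Z)`. -/
theorem bubble_conjV_left_rel (hA : Spr A) (hM : Spr M) (hE : Spr E) (hR : RelInv A M E) {X Z : MKer D F}
    (hX : Loc X) (hZ : Loc Z) (hEX : comp E X = comp X E) :
    bubble A (conjV M X) Z = tr (comp X (comp A Z)) - tr (comp (comp A X) Z) := by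
  unfold ExpKernelCalculus.bubble
  rw [sandwich_rel hA hM hE hR hX hZ hEX, tr_sub_loc (hX.comp (hA.comp_loc hZ)) ((hA.comp_loc hX).comp hZ)]

/-- Bubble with a second-slot contact (relative): `bubble A Y (conjV 𝕄 X′) = tr((A∘Y)∘X′) − tr((A∘X′)∘Y)`. -/
theorem bubble_conjV_right_rel (hA : Spr A) (hM : Spr M) (hE : Spr E) (hR : RelInv A M E) {Y Xp : MKer D F}
    (hY : Loc Y) (hXp : Loc Xp) (hEXp : comp E Xp = comp Xp E) :
    bubble A Y (conjV M Xp) = tr (comp (comp A Y) Xp) - tr (comp (comp A Xp) Y) := by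
  unfold ExpKernelCalculus.bubble
  rw [tr_comp_comm_loc (hA.comp_loc hY) (hA.comp_loc (loc_conjV hM hXp)).tame, sandwich_rel hA hM hE hR hXp hY hEXp,
    tr_sub_loc (hXp.comp (hA.comp_loc hY)) ((hA.comp_loc hXp).comp hY), tr_comp_comm_loc hXp (hA.comp_loc hY).tame]

/-- FIRST-ORDER DEFECT (relative): `tadpole A (conjW₁ V V′ X X′) = bubble A (conjV 𝕄 X) V′ + bubble A V (conjV 𝕄 X′)`. -/
theorem tadpole_conjW₁_rel (hA : Spr A) (hM : Spr M) (hE : Spr E) (hR : RelInv A M E) {V Vp X Xp : MKer D F}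
    (hV : Loc V) (hVp : Loc Vp) (hX : Loc X) (hXp : Loc Xp) (hEX : comp E X = comp X E) (hEXp : comp E Xp = comp Xp E) :
    tadpole A (conjW₁ V Vp X Xp) = bubble A (conjV M X) Vp + bubble A V (conjV M Xp) := by
  unfold conjW₁
  rw [tadpole_add hA ((hVp.comp hX).sub (hX.comp hVp)) ((hV.comp hXp).sub (hXp.comp hV)), tadpole_comm_pair hA hVp hX,
    tadpole_comm_pair hA hV hXp, bubble_conjV_left_rel hA hM hE hR hX hVp hEX, bubble_conjV_right_rel hA hM hE hR hV hXp hEXp,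
    tr_comp_comm_loc (hA.comp_loc hVp) hX.tame]

/-- QUADRATIC DEFECT (relative): `tadpole A (conjW₂ 𝕄 X X′ X₂) = bubble A (conjV 𝕄 X) (conjV 𝕄 X′)` — the `[𝕄, X₂]` part has tadpole
`tr(E∘X₂) − tr(E∘X₂) = 0`, the rest is cyclic re-association through the SANDWICHED rules. -/
theorem tadpole_conjW₂_rel (hA : Spr A) (hM : Spr M) (hE : Spr E) (hR : RelInv A M E) {X Xp X₂ : MKer D F}
    (hX : Loc X) (hXp : Loc Xp) (hX₂ : Loc X₂) (hEX : comp E X = comp X E) (hEXp : comp E Xp = comp Xp E)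
    (hEX₂ : comp E X₂ = comp X₂ E) : tadpole A (conjW₂ M X Xp X₂) = bubble A (conjV M X) (conjV M Xp) := by
  have hXXp := hX.comp hXp
  have hXpX := hXp.comp hX
  have hXM := hX.comp_spr hM
  have hXpM := hXp.comp_spr hM
  have hAX := hA.comp_loc hX
  have hAXp := hA.comp_loc hXp
  have hMXp := hM.comp_loc hXp
  have hMX₂ := hM.comp_loc hX₂
  have hX₂M := hX₂.comp_spr hM
  have hAMXp := hA.comp_loc hMXp
  have hP := (hXXp.comp_spr hM).add (hXpX.comp_spr hM)
  have hQ := (hXM.comp hXp).add (hXpM.comp hX)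
  have hEXXp : comp E (comp X Xp) = comp (comp X Xp) E := comm_comp hE hX hXp hEX hEXp
  have hEXpX : comp E (comp Xp X) = comp (comp Xp X) E := comm_comp hE hXp hX hEXp hEX
  -- the right-hand side
  rw [bubble_conjV_left_rel hA hM hE hR hX (loc_conjV hM hXp) hEX]
  unfold conjV
  rw [comp_sub_right_tame hA.tame hMXp.tame hXpM.tame, comp_sub_right_tame hX.tame hAMXp.tame (hA.comp_loc hXpM).tame,
    tr_sub_loc (hX.comp hAMXp) (hX.comp (hA.comp_loc hXpM)),
    comp_sub_right_tame hAX.tame hMXp.tame hXpM.tame, tr_sub_loc (hAX.comp hMXp) (hAX.comp hXpM)]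
  -- the left-hand side
  unfold conjW₂ ExpKernelCalculus.tadpole
  rw [comp_add_right_tame hA.tame (hP.sub hQ).tame (hMX₂.sub hX₂M).tame, tr_add_loc (hA.comp_loc (hP.sub hQ)) (hA.comp_loc (hMX₂.sub hX₂M)),
    comp_sub_right_tame hA.tame hP.tame hQ.tame, tr_sub_loc (hA.comp_loc hP) (hA.comp_loc hQ),
    comp_add_right_tame hA.tame (hXXp.comp_spr hM).tame (hXpX.comp_spr hM).tame,
    tr_add_loc (hA.comp_loc (hXXp.comp_spr hM)) (hA.comp_loc (hXpX.comp_spr hM)),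
    comp_add_right_tame hA.tame (hXM.comp hXp).tame (hXpM.comp hX).tame, tr_add_loc (hA.comp_loc (hXM.comp hXp)) (hA.comp_loc (hXpM.comp hX)),
    comp_sub_right_tame hA.tame hMX₂.tame hX₂M.tame, tr_sub_loc (hA.comp_loc hMX₂) (hA.comp_loc hX₂M)]
  have e1 : tr (comp A (comp (comp X Xp) M)) = tr (comp E (comp X Xp)) := trace_KYH_rel hA hM hE hR hXXp hEXXp
  have e2 : tr (comp A (comp (comp Xp X) M)) = tr (comp E (comp Xp X)) := trace_KYH_rel hA hM hE hR hXpX hEXpX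
  have e3 : tr (comp A (comp (comp X M) Xp)) = tr (comp (comp A X) (comp M Xp)) := by
    rw [comp_assoc_tame hA.tame hXM.tame hXp.tame, comp_assoc_tame hA.tame hX.tame hM.tame, ← comp_assoc_tame hAX.tame hM.tame hXp.tame]
  have e4 : tr (comp A (comp (comp Xp M) X)) = tr (comp X (comp A (comp Xp M))) := by
    rw [comp_assoc_tame hA.tame hXpM.tame hX.tame, ← tr_comp_comm_loc hX (hA.comp_loc hXpM).tame]
  have e5 : tr (comp A (comp M X₂)) = tr (comp E X₂) := trace_KHY_rel hA hM hE hR hX₂ hEX₂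
  have e6 : tr (comp A (comp X₂ M)) = tr (comp E X₂) := trace_KYH_rel hA hM hE hR hX₂ hEX₂
  have f1 : tr (comp X (comp A (comp M Xp))) = tr (comp E (comp Xp X)) := by
    rw [tr_comp_comm_loc hX hAMXp.tame, ← comp_assoc_tame hA.tame hMXp.tame hX.tame, ← comp_assoc_tame hM.tame hXp.tame hX.tame]
    exact trace_KHY_rel hA hM hE hR hXpX hEXpX
  have f4 : tr (comp (comp A X) (comp Xp M)) = tr (comp E (comp X Xp)) := by
    rw [← comp_assoc_tame hA.tame hX.tame hXpM.tame, comp_assoc_tame hX.tame hXp.tame hM.tame]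
    exact e1
  rw [e1, e2, e3, e4, e5, e6, f1, f4]
  ring

/-- **THE DEFECT IDENTITY, RELATIVE FORM** (kernel-level `jet₂_defect_relative` for the orthogonal congruence):
`tadpole A (conjW …) = bubble A (conjV 𝕄 X) V′ + bubble A V (conjV 𝕄 X′) + bubble A (conjV 𝕄 X) (conjV 𝕄 X′)`. -/
theorem conj_defect_rel (hA : Spr A) (hM : Spr M) (hE : Spr E) (hR : RelInv A M E) {V Vp X Xp X₂ : MKer D F}
    (hV : Loc V) (hVp : Loc Vp) (hX : Loc X) (hXp : Loc Xp) (hX₂ : Loc X₂) (hEX : comp E X = comp X E)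
    (hEXp : comp E Xp = comp Xp E) (hEX₂ : comp E X₂ = comp X₂ E) :
    tadpole A (conjW M V Vp X Xp X₂) =
      bubble A (conjV M X) Vp + bubble A V (conjV M Xp) + bubble A (conjV M X) (conjV M Xp) := by
  unfold conjW
  rw [tadpole_add hA (loc_conjW₁ hV hVp hX hXp) (loc_conjW₂ hM hX hXp hX₂), tadpole_conjW₁_rel hA hM hE hR hV hVp hX hXp hEX hEXp,
    tadpole_conjW₂_rel hA hM hE hR hX hXp hX₂ hEX hEXp hEX₂]

/-- **THE ASSEMBLED ONE-LOOP HESSIAN FORM IS INVARIANT UNDER CHART CONJUGATION — RELATIVE INVERSE** (kernel-level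
`jet₂_congruence_orthogonal_relative`): for spread `A`, `𝕄`, `E` with `RelInv A 𝕄 E` (BINDERS), localised `V, V′, W, X, X′, X₂` and
`E` commuting with `X, X′, X₂`:
`½·tadpole A (W + conjW 𝕄 V V′ X X′ X₂) − ½·bubble A (V + conjV 𝕄 X) (V′ + conjV 𝕄 X′) = ½·tadpole A W − ½·bubble A V V′`.
With `E = idK` this is an5's `hess_conj_invariant`. -/
theorem hess_conj_invariant_rel (hA : Spr A) (hM : Spr M) (hE : Spr E) (hR : RelInv A M E) {V Vp W X Xp X₂ : MKer D F}
    (hV : Loc V) (hVp : Loc Vp) (hW : Loc W) (hX : Loc X) (hXp : Loc Xp) (hX₂ : Loc X₂) (hEX : comp E X = comp X E)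
    (hEXp : comp E Xp = comp Xp E) (hEX₂ : comp E X₂ = comp X₂ E) :
    (1 / 2 : ℝ) * tadpole A (W + conjW M V Vp X Xp X₂) - (1 / 2 : ℝ) * bubble A (V + conjV M X) (Vp + conjV M Xp)
      = (1 / 2 : ℝ) * tadpole A W - (1 / 2 : ℝ) * bubble A V Vp := by
  have hcV := loc_conjV hM hX
  have hcVp := loc_conjV hM hXp
  rw [tadpole_add hA hW (loc_conjW hM hV hVp hX hXp hX₂), bubble_add_left hA hV hcV (hVp.add hcVp), bubble_add_right hA hV hVp hcVp,
    bubble_add_right hA hcV hVp hcVp, conj_defect_rel hA hM hE hR hV hVp hX hXp hX₂ hEX hEXp hEX₂]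
  ring

end Defect

end

end Summit.QuantumFields.BalabanUV.Beta.ChartConjugationRelative
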